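import Summits.ABC.IUTFork.Thm311RealInd1UnitsHNDichotomy
import Summits.ABC.IUTFork.Thm311RealInd1StripTwistJWFirstPlanes
import HarnessLib

/-!
# [IUTchIII] Thm 3.11 (i) (Ind1) at `v₇ = (√7)` of `ℚ(√7)`: the HOSHI–NISHIO UNIPOTENT FAMILY IS REALISED in print's (Ind1) strip
# part, modulo the group-level fact `JannsenWingbergTwistsFirst` — the realisation horn of Team R's row R9f-HN-UNIPOTENT

PROOF-ONLY file (abc-iut cell, Cor. 3.12 sub-crew, seat abc-iut-c312-1 = holder of record of the typed [IUTchIII] Thm. 3.11,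
gen 12; row «R14 FIRST-PLANE TWIST», part e = junction C312-1 × TEAM R).  TAKES NO SIDE on [IUTchIII] Cor. 3.12.

Team R (abc-iut-c312-14 gen 9, `Thm311RealInd1UnitsHNTransvection` p481415 / `…HNDichotomy` p481593) typed the `d = 2` shape of
Hoshi–Nishio's `*α^n_+` (RIMS-1931 Thm. 1.5) at the tame quadratic place `v₇ = (√7)` of `F₇ = ℚ(√7)`: the family `hnLin c`
(`x + y·Ω ↦ x + (y + c·x)·Ω`, `Ω = √7`), with the NORMAL FORM `eq_hnLin_of_unipotent_of_line` (every unipotent `Ω`-line-invariant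
`ℚ₇`-endomorphism IS `hnLin c`) and the conditional movers `ind1_strip_moves_baseSeg_of_hnRealised` / `…_M2_of_hnRealised`, whose
hypothesis — «some `φ ∈ Aut_top(G_{v₇})` realises some `psiHN c`, `c ≠ 0`, through `L₇`» — was left INLINE (D-0067).  THIS FILE
DISCHARGES THAT HYPOTHESIS MODULO THE NAMED FACT `JannsenWingbergTwistsFirst` (Jannsen–Wingberg 1982 §5.1 `n = 2` / Hoshi–Nishio *α at
`d(G) = 2` / Kondo 2025 proof of Thm. 2.3 case `d_k = 2`, v3 of `MLFGaloisJannsenWingbergTwists.lean`, p500987):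
* `UnitsShear.trace_omega` — `Tr_{K₇/ℚ₇}(Ω) = 0` (matrix of `Ω·` in `{1, Ω}`);
* `UnitsShear.localDeg_v7` — `[K_{v₇} : ℚ₇] = 2` in abc-iut-S7's currency;
* **`UnitsShear.exists_hnRealised_of_jannsenWingbergFirst`** — `∃ φ c, c ≠ 0 ∧ Realises v₇ L₇ (stripMulAut v₇ φ) (psiHN c)`: the
  first-pair shear `ψ₀ ∈ Real.ind1StripOf v₇ (galoisLog v₇)` of `exists_shear_of_jannsenWingbergFirst_of_localDeg_eq_two`
  (`ψ₀(x) = x + y_2^*(x)·y_1`, `Ker Tr = ℚ₇·y_1`) is unipotent and fixes the line `ℚ₇·Ω = Ker Tr`, hence IS `hnLin c` by Team R's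
  normal form, with `c ≠ 0` (`ψ₀ ≠ id`), and `galoisLog v₇ = analyticLogv F₇ v₇ = L₇` (w5-d216);
* **`UnitsShear.ind1_strip_moves_baseSeg_of_jannsenWingbergFirst`** — hence (Team R's `ind1_strip_moves_baseSeg_of_hnRealised` BY NAME)
  print's (Ind1) strip part at `v₇` MOVES the base-line target `baseSeg` (Hoshi's `𝒪^×_{k^{(d=1)}}` read through `L₇`), modulo the
  named fact — GAP row G-c312-14-R9f step (ii′): the realisation ∃-horn is now conditional on a PUBLISHED group-level fact instead of
  an inline hypothesis.  What stays open is exactly Team R's dichotomy datum: `psiHN c` moves the ideal-shaped `M₂` iff `1 < ‖c‖`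
  (`psiHN_image_M2_iff`), and the valuation of `c` is NOT pinned by print (`hn_family_M2_dichotomy`).
HONEST SCOPE: conditional theorems (binder `hJW`); nothing here asserts or refutes [IUTchIII] Cor. 3.12; NO abc claim; Team R's files are
consumed BY NAME, nothing restated or edited.  [claim: Mochizuki2012, status: disputed]; [cite: HoshiNishio2022OuterAutMLF, Thm 1.5, Lemma 2.3
(ii), Lemma 2.4]; [cite: Kondo2025OuterAutMLF, §2 proof of Thm 2.3 (case d_k = 2) p.10]; [cite: JannsenWingberg1982, §5.1 p.96].
typed ≠ proved; a conditional theorem discharges nothing it binds.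
-/

set_option autoImplicit false

noncomputable section

namespace Summit.ABC.IUTFork.Thm311.Real

open Literature.IUT.LogVolume Literature.NumberTheory.NumberFields
open Literature.AnabelianGeometry.AbsoluteAnabelian
open NumberField IsDedekindDomain

/-! ## 0. A coordinate form of the quadratic statement of record (generic place) -/

/-- The quadratic statement of record with `Ker(Tr) = ℚ_p·y_0` read on COORDINATES: every trace-zero `z` has `y_1^*(z) = 0` (so lies on
the line `ℚ_p·y_0`).  (A trace-free interface for consumers working in a fixed coordinate model of `K_v`.) [claim: Mochizuki2012, status: disputed]
[cite: Kondo2025OuterAutMLF, §2 proof of Thm 2.3 (case d_k = 2) p.10] -/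
theorem exists_shear_coord_of_jannsenWingbergFirst_of_localDeg_eq_two {F : Type} [Field F] [NumberField F]
    (v : HeightOneSpectrum (𝓞 F)) (hJW : JannsenWingbergTwistsFirst)
    (p : ℕ) [Fact p.Prime] (hv : ((p : ℕ) : 𝓞 F) ∈ v.asIdeal) (hp2 : p ≠ 2) (hd : localDeg F v = 2) :
    ∃ (y : Module.Basis (Fin 2) ℚ_[p] (RescaledCompletion F p v hv)) (ψ₀ : v.adicCompletion F ≃+ v.adicCompletion F),
      ψ₀ ∈ ind1StripOf v (galoisLog v) ∧
      (∀ x : RescaledCompletion F p v hv,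
        RescaledCompletion.of F p v hv (ψ₀ ((RescaledCompletion.of F p v hv).symm x)) = x + y.coord 1 x • y 0) ∧
      (∀ z : RescaledCompletion F p v hv, Algebra.trace ℚ_[p] (RescaledCompletion F p v hv) z = 0 → y.coord 1 z = 0) := by
  obtain ⟨y, ψ₀, hψ₀, hT₀, -, -, hker⟩ := exists_shear_of_jannsenWingbergFirst_of_localDeg_eq_two v hJW p hv hp2 hd
  refine ⟨y, ψ₀, hψ₀, hT₀, fun z hz => ?_⟩
  have hmem : z ∈ Submodule.span ℚ_[p] {y 0} := by
    rw [← hker, LinearMap.mem_ker]; exact hz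
  obtain ⟨a, ha⟩ := Submodule.mem_span_singleton.mp hmem
  rw [← ha, map_smul, Module.Basis.coord_apply, Module.Basis.repr_self, Finsupp.single_apply, if_neg zero_ne_one, smul_zero]

end Summit.ABC.IUTFork.Thm311.Real

namespace Summit.ABC.IUTFork.Thm311.Real.UnitsShear

open Literature.IUT.LogVolume Literature.NumberTheory.NumberFields
open Literature.AnabelianGeometry.AbsoluteAnabelian
open NumberField IsDedekindDomain Metric
open Summit.ABC.IUTFork.RamifiedMover
open Summit.ABC.IUTFork.Thm311.Real

/-! ## 1. Two facts about `K₇` -/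

/-- `Ω·Ω = 7` (as `algebraMap ℚ₇ K₇ 7`). [folklore] -/
theorem omega_mul_omega : Omega * Omega = algebraMap ℚ_[7] K7 7 := by
  have h := omega_sq'
  rwa [sq] at h

/-- The trace of `Ω` as the two diagonal entries of the matrix of `Ω·` in the basis `{1, Ω}`. [folklore] -/
theorem trace_omega_eq_repr : Algebra.trace ℚ_[7] K7 Omega = bs7.repr (Omega * bs7 0) 0 + bs7.repr (Omega * bs7 1) 1 := by
  rw [Algebra.trace_eq_matrix_trace bs7, Matrix.trace, Fin.sum_univ_two, Matrix.diag_apply, Matrix.diag_apply,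
    Algebra.leftMulMatrix_eq_repr_mul, Algebra.leftMulMatrix_eq_repr_mul]

/-- **`Tr_{K₇/ℚ₇}(Ω) = 0`**: in the basis `{1, Ω}` multiplication by `Ω` has matrix `[[0, 7], [1, 0]]`. [folklore] -/
theorem trace_omega : Algebra.trace ℚ_[7] K7 Omega = 0 := by
  rw [trace_omega_eq_repr, bs7_zero, bs7_one, mul_one, omega_mul_omega]
  have h0 : bs7.repr Omega 0 = 0 := by
    have h := (repr_smul_omega 1).1
    rwa [one_smul] at h
  have h1 : bs7.repr (algebraMap ℚ_[7] K7 7) 1 = 0 := by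
    rw [Algebra.algebraMap_eq_smul_one, map_smul, Finsupp.smul_apply, repr_one.2, smul_zero]
  rw [h0, h1, add_zero]

/-- `[K_{v₇} : ℚ₇] = 2` in abc-iut-S7's currency `localDeg`. [folklore] -/
theorem localDeg_v7 : localDeg ↥F7 v7 = 2 := by
  rw [localDeg, ramificationIdx_v7, inertiaDeg_v7]

/-! ## 2. The Hoshi–Nishio family is realised in print's (Ind1) strip part, modulo `JannsenWingbergTwistsFirst` -/

/-- **THE REALISATION HORN OF ROW R9f-HN-UNIPOTENT, MODULO THE NAMED FACT.**  Assume `JannsenWingbergTwistsFirst`.  Then some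
`φ ∈ Aut_top(G_{v₇})` realises, through THE equivariant lift and the analytic logarithm `L₇`, a NONZERO member `psiHN c` of Team R's
Hoshi–Nishio unipotent family: `∃ φ c, c ≠ 0 ∧ Realises v₇ L₇ (stripMulAut v₇ φ) (psiHN c)`.  Proof: the first-pair shear
`ψ₀ ∈ Real.ind1StripOf v₇ (galoisLog v₇)` (`exists_shear_of_jannsenWingbergFirst_of_localDeg_eq_two`: `ψ₀(x) = x + y_2^*(x)·y_1`,
`Ker(Tr) = ℚ₇·y_1`) is unipotent and maps the line `ℚ₇·Ω ⊆ Ker(Tr)` to itself, so it IS `hnLin c` (Team R's normal form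
`eq_hnLin_of_unipotent_of_line`), `c ≠ 0` since `ψ₀(y_2) ≠ y_2`; and `galoisLog v₇ = L₇`. [claim: Mochizuki2012, status: disputed]
[cite: HoshiNishio2022OuterAutMLF, Thm 1.5 and Lemma 2.3 (ii)] [cite: Kondo2025OuterAutMLF, §2 proof of Thm 2.3 (case d_k = 2) p.10] -/
theorem exists_hnRealised_of_jannsenWingbergFirst (hJW : JannsenWingbergTwistsFirst) :
    ∃ (φ : Gal v7 ≃ₜ* Gal v7) (c : ℚ_[7]), c ≠ 0 ∧ Realises v7 L7 (stripMulAut v7 φ) (psiHN c) := by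
  obtain ⟨y, ψ₀, hψ₀, hT₀, hcoord⟩ :=
    exists_shear_coord_of_jannsenWingbergFirst_of_localDeg_eq_two v7 hJW 7 seven_mem_v7 (by norm_num) localDeg_v7
  -- the shear as a linear endomorphism of `K₇`
  let T : K7 →ₗ[ℚ_[7]] K7 := LinearMap.id + (y.coord 1).smulRight (y 0)
  have hT : ∀ x, T x = x + y.coord 1 x • y 0 := fun x => rfl
  have hc10 : y.coord 1 (y 0) = 0 := by
    rw [Module.Basis.coord_apply, Module.Basis.repr_self, Finsupp.single_apply, if_neg zero_ne_one]
  -- unipotent: `(T − id)² = 0`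
  have hsub : ∀ x, (T - LinearMap.id : K7 →ₗ[ℚ_[7]] K7) x = y.coord 1 x • y 0 := fun x => by
    rw [LinearMap.sub_apply, LinearMap.id_apply, hT, add_sub_cancel_left]
  have hunip : (T - LinearMap.id) ∘ₗ (T - LinearMap.id) = 0 := by
    apply LinearMap.ext
    intro x
    rw [LinearMap.comp_apply, hsub, hsub, map_smul, hc10, smul_eq_mul, mul_zero, zero_smul, LinearMap.zero_apply]
  -- `Ω` is trace-zero, hence on the line `ℚ₇·y_0`: `y_1^*(Ω) = 0`, so `T Ω = Ω`
  have hΩ : y.coord 1 Omega = 0 := hcoord Omega trace_omega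
  have hline : ∃ s' : ℚ_[7], T Omega = s' • Omega :=
    ⟨1, by rw [hT, hΩ, zero_smul, add_zero, one_smul]⟩
  -- Team R's normal form
  obtain ⟨c, hTc⟩ := eq_hnLin_of_unipotent_of_line hunip hline
  -- `c ≠ 0`: `T ≠ id`
  have hc : c ≠ 0 := by
    rw [← hnLin_ne_id_iff, ← hTc]
    intro hid
    have h := congrArg (fun f : K7 →ₗ[ℚ_[7]] K7 => f (y 1)) hid
    change T (y 1) = LinearMap.id (y 1) at h
    rw [LinearMap.id_apply, hT, add_eq_left, Module.Basis.coord_apply, Module.Basis.repr_self, Finsupp.single_eq_same,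
      one_smul] at h
    exact y.ne_zero 0 h
  -- `ψ₀ = psiHN c`
  have hψeq : ψ₀ = psiHN c := by
    refine AddEquiv.ext fun x => ?_
    have h := hT₀ (e7 x)
    change e7 (ψ₀ (e7.symm (e7 x))) = _ at h
    rw [e7.symm_apply_apply] at h
    rw [psiHN_apply, ← hTc, hT, ← h, e7.symm_apply_apply]
  -- membership, over the analytic logarithm `L₇`
  rw [galoisLog_eq_analyticLogv, hψeq] at hψ₀
  obtain ⟨-, -, φ, hφ⟩ := hψ₀
  exact ⟨φ, c, hc, hφ⟩

/-- **PRINT'S (Ind1) STRIP PART AT `v₇` MOVES THE BASE-LINE TARGET `baseSeg`, modulo `JannsenWingbergTwistsFirst`** — Team R's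
`ind1_strip_moves_baseSeg_of_hnRealised` (p481593) with its inline realisation hypothesis supplied by
`exists_hnRealised_of_jannsenWingbergFirst` (Hoshi–Nishio Lemma 2.4 / Hoshi RIMS-1960 Lemma 3.1 (v) reading at the real log-shell of
`v₇`).  The ideal-shaped target `M₂` is NOT claimed to move: that needs `1 < ‖c‖`, a datum print does not pin (`hn_family_M2_dichotomy`).
[claim: Mochizuki2012, status: disputed] [cite: HoshiNishio2022OuterAutMLF, Lemma 2.4 p.8] -/
theorem ind1_strip_moves_baseSeg_of_jannsenWingbergFirst (hJW : JannsenWingbergTwistsFirst) :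
    ∃ ψ ∈ ind1StripOf v7 L7, ⇑ψ '' (baseSeg : Set (v7.adicCompletion ↥F7)) ≠ baseSeg :=
  ind1_strip_moves_baseSeg_of_hnRealised (exists_hnRealised_of_jannsenWingbergFirst hJW)

/-- The dichotomy restated with the realisation supplied: modulo `JannsenWingbergTwistsFirst` there IS a realised `psiHN c`, `c ≠ 0`, in
print's (Ind1) strip part at `v₇`, and it fixes the ideal-shaped `M₂` iff `‖c‖ ≤ 1` — the one residual datum of row R9f.
[claim: Mochizuki2012, status: disputed] [cite: HoshiNishio2022OuterAutMLF, Thm 1.5] -/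
theorem exists_psiHN_mem_ind1StripOf_and_M2_iff (hJW : JannsenWingbergTwistsFirst) :
    ∃ c : ℚ_[7], c ≠ 0 ∧ psiHN c ∈ ind1StripOf v7 L7 ∧
      (⇑(psiHN c) '' (M2 : Set (v7.adicCompletion ↥F7)) = M2 ↔ ‖c‖ ≤ 1) := by
  obtain ⟨φ, c, hc, hφ⟩ := exists_hnRealised_of_jannsenWingbergFirst hJW
  exact ⟨c, hc, psiHN_mem_ind1StripOf hφ, psiHN_image_M2_iff c⟩

end Summit.ABC.IUTFork.Thm311.Real.UnitsShear

end
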